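import Mathlib
import Summits.ResolutionOfSingularities.ResolutionOfSingularities.Theorems.WeightedInvariantLocalWeightedDropTOT2StepsDimA
import Summits.ResolutionOfSingularities.ResolutionOfSingularities.Theorems.WeightedInvariantLocalWeightedDropTOT2StepsDimB
import Summits.ResolutionOfSingularities.ResolutionOfSingularities.Theorems.WeightedInvariantLocalWeightedDropTOT2BranchCoordChange
import Summits.ResolutionOfSingularities.ResolutionOfSingularities.Theorems.WeightedInvariantLocalWeightedDropTOT2PairValFinite
import Summits.ResolutionOfSingularities.ResolutionOfSingularities.Theorems.WeightedInvariantLocalWeightedDropTOT2TopPrimesChartComap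
import Summits.ResolutionOfSingularities.ResolutionOfSingularities.Theorems.WeightedInvariantLocalWeightedDropTOT2TopPrimesShearRecentre
import Summits.ResolutionOfSingularities.ResolutionOfSingularities.Theorems.WeightedInvariantLocalWeightedDropTOT2BridgePresByStep
import Summits.ResolutionOfSingularities.ResolutionOfSingularities.Theorems.WeightedInvariantLocalWeightedDropPolyDescentCompare
import Summits.ResolutionOfSingularities.ResolutionOfSingularities.Theorems.WeightedInvariantLocalWeightedDropTOT2NoLinePrime

/-!
# TOT2-LINE (P3) B6 GLUE: THE TWO LAWS OF THE CONFLICT BUDGET `conflictBudgetD`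

ENGINE crux `stmt-ResolutionOfSingularities-8899` (`LocalWeightedDrop`), skeleton v35 (2e806da509994632), registered stub `stub_conflictBudget` (P3).
[OURS · L1 W4.3 · chain w43 · res-L1-w43-stub-2 g6 (owner of (P3)); def-free; nothing here is a statement of any manuscript; AI-produced,
gate-checked, weaker than expert review.]

The six step theorems (`…TOT2StepsDimA/B`) are instantiated on the six successor families of `PolyDescent.SuccFamilySel` /
`PolyDescent.PointFamilySel`, their bricks discharged by name: B3 (`branchVal_comap_monomialChart`, `…_coordChange`, res-L1-w43-stub-1), B4
(`comap_chart*_mem_topPrimes`, `comap_shearRecentre_mem_topPrimes`, res-L1-w43-lead-1), D3 (`pairVal_lt_top`), injectivity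
(`eq_of_comap_eq_of_monomialChart`, `…_coordChange_eq`), the line prime (`exists_linePrimeD_of_isPermissibleTwoT`) and the no-line fact D8 (`X_one_not_mem_of_wellPrepared`, res-L1-w43-stub-1).
* `conflictBudgetD_succ_law`, `conflictBudgetD_conf_law`; the registered stub `stub_conflictBudget` follows in `…TOT2ConflictBudget`.
-/

set_option linter.dupNamespace false -- mandated namespace of this single-conjunct summit

noncomputable section

namespace Summit.ResolutionOfSingularities.ResolutionOfSingularities.Theorems

namespace TOT2Branch

open MvPowerSeries IsLocalRing PolyDescent MonicDescent WildMonic Literature.AlgebraicGeometry.Resolution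

variable {k : Type} [Field k]

/-! ## Substitutions that fix plane series -/

/-- A substitution fixing `u₁`, `u₂` fixes every plane series. -/
theorem subst_toThree_of_fix {c : Fin 3 → MvPowerSeries (Fin 3) k} (hc : ∀ i, constantCoeff (c i) = 0)
    (h0 : c 0 = X 0) (h1 : c 1 = X 1) (g : MvPowerSeries (Fin 2) k) : subst c (toThree g) = toThree g := by
  rw [toThree]
  show subst c (rename _ g) = rename _ g
  rw [subst_rename_eq_rename_subst c hc ![X 0, X 1] (fun i => by fin_cases i <;> simp)
    (fun i => by fin_cases i <;> simp [rename_X, h0, h1, succAbove_two_one]) g]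
  congr 1
  rw [show (![X 0, X 1] : Fin 2 → MvPowerSeries (Fin 2) k) = X ∘ id from funext fun i => by fin_cases i <;> rfl, ← rename_eq_subst,
    rename_id_apply]

/-- The re-centring fixes plane series. -/
theorem subst_recentre_toThree {ψ : MvPowerSeries (Fin 2) k} (hψ : constantCoeff ψ = 0) (g : MvPowerSeries (Fin 2) k) :
    subst (NCPoly.recentre ψ) (toThree g) = toThree g :=
  subst_toThree_of_fix (NCPoly.constantCoeff_recentre hψ) (NCPoly.recentre_of_ne ψ (by decide)) (NCPoly.recentre_of_ne ψ (by decide)) g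

/-- The shear on plane series. -/
theorem subst_shear3_toThree (h g : MvPowerSeries (Fin 2) k) : subst (shear3 h) (toThree g) = toThree (shear h g) := by
  rw [toThree]; exact subst_shear3_rename h g

section Laws

variable (p : ℕ) [Fact p.Prime] [CharP k p] [IsAlgClosed k] {d : ℕ} {A : Fin d → MvPowerSeries (Fin 2) k} {N : Finset (Fin 2)}
  (hctx : ∃ (b : MvPowerSeries (Fin (2 + 1)) k) (δ : TameFourTupleDrop.Decoration k 2) (Θ : Fin (2 + 1) → MvPowerSeries (Fin (2 + 1)) k),
    TameFourTupleDrop.Admissible b δ ∧ 2 ≤ δ.o ∧ δ.c = d ∧ δ.PresBy d A N Θ)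
  (hin : InPoly d A)

include p hctx hin

/-- STEP `V(y,u₁)`. -/
theorem law_divOne (h1 : IsPermissibleOneT d A) :
    conflictBudgetD d (divOneT d A) (insert 0 (N.filter fun l => l = 1)) ≤ conflictBudgetD d A N := by
  have hd2 : 2 ≤ d := NCBranchPrimes.two_le_of_presContext hctx
  have _ := hin
  have hc0 : ∀ i, constantCoeff ((![X 0, X 1, X 0 * X 2] : Fin 3 → MvPowerSeries (Fin 3) k) i) = 0 := by
    intro i; fin_cases i <;> simp
  have ha : HasSubst (![X 0, X 1, X 0 * X 2] : Fin 3 → MvPowerSeries (Fin 3) k) := hasSubst_of_constantCoeff_zero hc0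
  refine conflictBudgetD_le_of_planeFixingD p (substAlgHom ha : MvPowerSeries (Fin 3) k →ₐ[k] MvPowerSeries (Fin 3) k) 0
    (fun g => by rw [substAlgHom_apply]; exact subst_toThree_of_fix hc0 (by simp) (by simp) g)
    (fun P' _ hdim' hX => ?_) (fun P' hP' hdim' hX => comap_chartDivOne_mem_topPrimes (by omega) A h1 hP' hX hdim')
    (fun P Q hP hQ hne hdP hdQ => pairVal_lt_top hd2 hP hQ hne hdP hdQ)
    (fun P' Q' hP hQ hdP hdQ hXP hXQ h => comap_chartDivOne_injective ha hP hQ hdP hdQ hXP hXQ h) ?_ hctx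
  · obtain ⟨hd, hv⟩ := branchVal_comap_chartDivOne ha P' hdim' hX
    exact ⟨hd, fun f => by rw [hv f, substAlgHom_apply]⟩
  · refine betaTwo_congr ?_
    rw [isPermissibleTwoT_divOneT_iff h1]
    simp

/-- STEP `V(y,u₂)`. -/
theorem law_divTwo (h2 : IsPermissibleTwoT d A) :
    conflictBudgetD d (divTwoT d A) (insert 1 (N.filter fun l => l = 0)) ≤ conflictBudgetD d A N := by
  have hd2 : 2 ≤ d := NCBranchPrimes.two_le_of_presContext hctx
  have _ := hin
  have hc0 : ∀ i, constantCoeff ((![X 0, X 1, X 1 * X 2] : Fin 3 → MvPowerSeries (Fin 3) k) i) = 0 := by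
    intro i; fin_cases i <;> simp
  have ha : HasSubst (![X 0, X 1, X 1 * X 2] : Fin 3 → MvPowerSeries (Fin 3) k) := hasSubst_of_constantCoeff_zero hc0
  refine conflictBudgetD_le_of_planeFixingD p (substAlgHom ha : MvPowerSeries (Fin 3) k →ₐ[k] MvPowerSeries (Fin 3) k) 1
    (fun g => by rw [substAlgHom_apply]; exact subst_toThree_of_fix hc0 (by simp) (by simp) g)
    (fun P' _ hdim' hX => ?_) (fun P' hP' hdim' hX => comap_chartDivTwo_mem_topPrimes (by omega) A h2 hP' hX hdim')
    (fun P Q hP hQ hne hdP hdQ => pairVal_lt_top hd2 hP hQ hne hdP hdQ)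
    (fun P' Q' hP hQ hdP hdQ hXP hXQ h => comap_chartDivTwo_injective ha hP hQ hdP hdQ hXP hXQ h) ?_ hctx
  · obtain ⟨hd, hv⟩ := branchVal_comap_chartDivTwo ha P' hdim' hX
    exact ⟨hd, fun f => by rw [hv f, substAlgHom_apply]⟩
  · exact betaTwo_congr (iff_of_true (Or.inl (by simp)) (Or.inr h2))

/-- STEP `u₁`-ORIGIN (with the conflict clause). -/
theorem law_blowOne :
    conflictBudgetD d (blowOneT d A) (insert 0 (N.filter fun l => l = 1)) ≤ conflictBudgetD d A N ∧
      (NCPoly.Conflict d A N → conflictBudgetD d (blowOneT d A) (insert 0 (N.filter fun l => l = 1)) < conflictBudgetD d A N) := by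
  have hd2 : 2 ≤ d := NCBranchPrimes.two_le_of_presContext hctx
  have hc0 : ∀ i, constantCoeff ((![X 0, X 0 * X 1, X 0 * X 2] : Fin 3 → MvPowerSeries (Fin 3) k) i) = 0 := by
    intro i; fin_cases i <;> simp
  have ha : HasSubst (![X 0, X 0 * X 1, X 0 * X 2] : Fin 3 → MvPowerSeries (Fin 3) k) := hasSubst_of_constantCoeff_zero hc0
  have hB3 : ∀ (P' : Ideal (MvPowerSeries (Fin 3) k)) [P'.IsPrime], ringKrullDim (MvPowerSeries (Fin 3) k ⧸ P') = 1 →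
      (X 0 : MvPowerSeries (Fin 3) k) ∉ P' →
      ringKrullDim (MvPowerSeries (Fin 3) k ⧸ P'.comap (substAlgHom ha : MvPowerSeries (Fin 3) k →ₐ[k] MvPowerSeries (Fin 3) k)) = 1 ∧
        ∀ f, branchVal (P'.comap (substAlgHom ha : MvPowerSeries (Fin 3) k →ₐ[k] MvPowerSeries (Fin 3) k)) f =
          branchVal P' ((substAlgHom ha : MvPowerSeries (Fin 3) k →ₐ[k] MvPowerSeries (Fin 3) k) f) := by
    intro P' _ hdim' hX
    obtain ⟨hd, hv⟩ := branchVal_comap_chartOne ha P' hdim' hX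
    exact ⟨hd, fun f => by rw [hv f, substAlgHom_apply]⟩
  have hB4 := fun (P' : Ideal (MvPowerSeries (Fin 3) k)) (hP' : P' ∈ topPrimes d (blowOneT d A))
      (hdim' : ringKrullDim (MvPowerSeries (Fin 3) k ⧸ P') = 1) (hX : (X 0 : MvPowerSeries (Fin 3) k) ∉ P') =>
    comap_chartOne_mem_topPrimes (by omega) A hin.2.1 hP' hX hdim'
  refine ⟨(conflictBudgetD_blowOneT_leD (substAlgHom ha : MvPowerSeries (Fin 3) k →ₐ[k] MvPowerSeries (Fin 3) k) p
      (fun f => substAlgHom_apply ha f) hB3 hB4 (fun P Q hP hQ hne hdP hdQ => pairVal_lt_top hd2 hP hQ hne hdP hdQ)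
      (fun P' Q' hP hQ hdP hdQ hXP hXQ h => comap_chartOne_injective ha hP hQ hdP hdQ hXP hXQ h) hctx hin rfl).1,
    fun hconf => conflictBudgetD_blowOneT_ltD (substAlgHom ha : MvPowerSeries (Fin 3) k →ₐ[k] MvPowerSeries (Fin 3) k) p
      (fun f => substAlgHom_apply ha f) hB3 hB4 (fun P Q hP hQ hne hdP hdQ => pairVal_lt_top hd2 hP hQ hne hdP hdQ)
      (fun P' Q' hP hQ hdP hdQ hXP hXQ h => comap_chartOne_injective ha hP hQ hdP hdQ hXP hXQ h) hctx hin hconf rfl⟩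

/-- STEP `u₂`-ORIGIN (with the conflict clause). -/
theorem law_blowTwo :
    conflictBudgetD d (blowTwoT d A) (insert 1 (N.filter fun l => l = 0)) ≤ conflictBudgetD d A N ∧
      (NCPoly.Conflict d A N → conflictBudgetD d (blowTwoT d A) (insert 1 (N.filter fun l => l = 0)) < conflictBudgetD d A N) := by
  have hd2 : 2 ≤ d := NCBranchPrimes.two_le_of_presContext hctx
  have hc0 : ∀ i, constantCoeff ((![X 0 * X 1, X 1, X 1 * X 2] : Fin 3 → MvPowerSeries (Fin 3) k) i) = 0 := by
    intro i; fin_cases i <;> simp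
  have ha : HasSubst (![X 0 * X 1, X 1, X 1 * X 2] : Fin 3 → MvPowerSeries (Fin 3) k) := hasSubst_of_constantCoeff_zero hc0
  have hB3 : ∀ (P' : Ideal (MvPowerSeries (Fin 3) k)) [P'.IsPrime], ringKrullDim (MvPowerSeries (Fin 3) k ⧸ P') = 1 →
      (X 1 : MvPowerSeries (Fin 3) k) ∉ P' →
      ringKrullDim (MvPowerSeries (Fin 3) k ⧸ P'.comap (substAlgHom ha : MvPowerSeries (Fin 3) k →ₐ[k] MvPowerSeries (Fin 3) k)) = 1 ∧
        ∀ f, branchVal (P'.comap (substAlgHom ha : MvPowerSeries (Fin 3) k →ₐ[k] MvPowerSeries (Fin 3) k)) f =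
          branchVal P' ((substAlgHom ha : MvPowerSeries (Fin 3) k →ₐ[k] MvPowerSeries (Fin 3) k) f) := by
    intro P' _ hdim' hX
    obtain ⟨hd, hv⟩ := branchVal_comap_chartTwo ha P' hdim' hX
    exact ⟨hd, fun f => by rw [hv f, substAlgHom_apply]⟩
  have hB4 := fun (P' : Ideal (MvPowerSeries (Fin 3) k)) (hP' : P' ∈ topPrimes d (blowTwoT d A))
      (hdim' : ringKrullDim (MvPowerSeries (Fin 3) k ⧸ P') = 1) (hX : (X 1 : MvPowerSeries (Fin 3) k) ∉ P') =>
    comap_chartTwo_mem_topPrimes (by omega) A hin.2.1 hP' hX hdim'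
  refine ⟨(conflictBudgetD_blowTwoT_leD (substAlgHom ha : MvPowerSeries (Fin 3) k →ₐ[k] MvPowerSeries (Fin 3) k) p
      (fun f => substAlgHom_apply ha f) hB3 hB4 (fun P Q hP hQ hne hdP hdQ => pairVal_lt_top hd2 hP hQ hne hdP hdQ)
      (fun P' Q' hP hQ hdP hdQ hXP hXQ h => comap_chartTwo_injective ha hP hQ hdP hdQ hXP hXQ h) hctx rfl).1,
    fun hconf => conflictBudgetD_blowTwoT_ltD (substAlgHom ha : MvPowerSeries (Fin 3) k →ₐ[k] MvPowerSeries (Fin 3) k) p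
      (fun f => substAlgHom_apply ha f) hB3 hB4 (fun P Q hP hQ hne hdP hdQ => pairVal_lt_top hd2 hP hQ hne hdP hdQ)
      (fun P' Q' hP hQ hdP hdQ hXP hXQ h => comap_chartTwo_injective ha hP hQ hdP hdQ hXP hXQ h) hctx hin hconf rfl⟩

/-- STEP TRANSLATED POINT `c ≠ 0` (with the conflict clause): `Φ = chartOne ∘ recentre ψ₁ ∘ shear3 (C c)`. -/
theorem law_translated {c : k} (hc0 : c ≠ 0) :
    conflictBudgetD d (blowOneT d (shift d (shearT (C c) A) (prepSelWP d (shearT (C c) A)))) {0} ≤ conflictBudgetD d A N ∧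
      (NCPoly.Conflict d A N →
        conflictBudgetD d (blowOneT d (shift d (shearT (C c) A) (prepSelWP d (shearT (C c) A)))) {0} < conflictBudgetD d A N) := by
  have hd2 : 2 ≤ d := NCBranchPrimes.two_le_of_presContext hctx
  have hprep : IsPrepRecentring d (shearT (C c) A) (prepSelWP d (shearT (C c) A)) :=
    TameFourTupleDrop.isPrepRecentring_prepSelWP_all d _ (isPosT_shearT (C c) hin.2.1)
  have hψ₁ : constantCoeff (prepSelWP d (shearT (C c) A)) = 0 := hprep.1
  have hpos₁ : IsPosT d (shift d (shearT (C c) A) (prepSelWP d (shearT (C c) A))) := hprep.2.1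
  -- the three substitutions, kept opaque
  have hc1 : ∀ i, constantCoeff ((![X 0, X 0 * X 1, X 0 * X 2] : Fin 3 → MvPowerSeries (Fin 3) k) i) = 0 := by
    intro i; fin_cases i <;> simp
  have ha : HasSubst (![X 0, X 0 * X 1, X 0 * X 2] : Fin 3 → MvPowerSeries (Fin 3) k) := hasSubst_of_constantCoeff_zero hc1
  have hρ0 := NCPoly.constantCoeff_recentre hψ₁
  have hσ0 := constantCoeff_shear3 (C c : MvPowerSeries (Fin 2) k)
  obtain ⟨Φ₁, hΦ₁def⟩ : ∃ Φ₁ : MvPowerSeries (Fin 3) k →ₐ[k] MvPowerSeries (Fin 3) k, Φ₁ = substAlgHom ha := ⟨_, rfl⟩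
  obtain ⟨ρ, hρdef⟩ : ∃ ρ : MvPowerSeries (Fin 3) k →ₐ[k] MvPowerSeries (Fin 3) k,
    ρ = substAlgHom (hasSubst_of_constantCoeff_zero hρ0) := ⟨_, rfl⟩
  obtain ⟨σ, hσdef⟩ : ∃ σ : MvPowerSeries (Fin 3) k →ₐ[k] MvPowerSeries (Fin 3) k,
    σ = substAlgHom (hasSubst_of_constantCoeff_zero hσ0) := ⟨_, rfl⟩
  obtain ⟨Φ, hΦdef⟩ : ∃ Φ : MvPowerSeries (Fin 3) k →ₐ[k] MvPowerSeries (Fin 3) k, Φ = (Φ₁.comp ρ).comp σ := ⟨_, rfl⟩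
  have hΦapp : ∀ f, Φ f = Φ₁ (ρ (σ f)) := fun f => by rw [hΦdef, AlgHom.comp_apply, AlgHom.comp_apply]
  have hcomap : ∀ I : Ideal (MvPowerSeries (Fin 3) k), I.comap Φ = ((I.comap Φ₁).comap ρ).comap σ := fun I => by
    rw [hΦdef, Ideal.comap_comapₐ, Ideal.comap_comapₐ, AlgHom.comp_assoc]
  -- values on variables and plane series
  have h1X : ∀ i, Φ₁ (X i) = (![X 0, X 0 * X 1, X 0 * X 2] : Fin 3 → MvPowerSeries (Fin 3) k) i := fun i => by
    rw [hΦ₁def, substAlgHom_apply, subst_X ha]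
  have h1fix : Φ₁ (X 0) = X 0 := by rw [h1X]; rfl
  have h1X1 : Φ₁ (X 1) = X 0 * X 1 := by rw [h1X]; rfl
  have hmon₁ : ∀ i : Fin 3, Φ₁ (X i) = X i ∨ Φ₁ (X i) = X 0 * X i := by
    intro i; rw [h1X]; fin_cases i <;> simp
  have h1C : Φ₁ (C c) = C c := Φ₁.commutes c
  have h1₂ : ∀ g : MvPowerSeries (Fin 2) k, Φ₁ (toThree g) = toThree (subst (![X 0, X 0 * X 1] : Fin 2 → MvPowerSeries (Fin 2) k) g) := by
    intro g
    rw [hΦ₁def, substAlgHom_apply, toThree]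
    exact subst_rename_eq_rename_subst _ hc1 _ (fun i => by fin_cases i <;> simp)
      (fun i => by fin_cases i <;> simp [rename_X, map_mul, succAbove_two_one]) g
  have hσX : ∀ i, σ (X i) = shear3 (C c : MvPowerSeries (Fin 2) k) i := fun i => by
    rw [hσdef, substAlgHom_apply, subst_X (hasSubst_of_constantCoeff_zero hσ0)]
  have hσX0 : σ (X 0) = X 0 := by rw [hσX]; rfl
  have hσX1 : σ (X 1) = X 1 + X 0 * C c := by
    rw [hσX]; show X 1 + X 0 * rename _ (C c) = _; rw [rename_C]
  have hσ₂ : ∀ g : MvPowerSeries (Fin 2) k, σ (toThree g) = toThree (shear (C c) g) := fun g => by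
    rw [hσdef, substAlgHom_apply]; exact subst_shear3_toThree _ g
  have hρX : ∀ i, ρ (X i) = NCPoly.recentre (prepSelWP d (shearT (C c) A)) i := fun i => by
    rw [hρdef, substAlgHom_apply, subst_X (hasSubst_of_constantCoeff_zero hρ0)]
  have hρX0 : ρ (X 0) = X 0 := by rw [hρX]; exact NCPoly.recentre_of_ne _ (by decide)
  have hρX1 : ρ (X 1) = X 1 := by rw [hρX]; exact NCPoly.recentre_of_ne _ (by decide)
  have hρC : ρ (C c) = C c := ρ.commutes c
  have hρ₂ : ∀ g : MvPowerSeries (Fin 2) k, ρ (toThree g) = toThree g := fun g => by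
    rw [hρdef, substAlgHom_apply]; exact subst_recentre_toThree hψ₁ g
  have hΦX0 : Φ (X 0) = X 0 := by rw [hΦapp, hσX0, hρX0, h1fix]
  have hΦX1 : Φ (X 1) = X 0 * (X 1 + C c) := by
    rw [hΦapp, hσX1, map_add, map_mul, hρX1, hρX0, hρC, map_add, map_mul, h1X1, h1fix, h1C]; ring
  have hs2 : HasSubst (![X 0, X 1 + X 0 * C c] : Fin 2 → MvPowerSeries (Fin 2) k) :=
    hasSubst_of_constantCoeff_zero fun i => by fin_cases i <;> simp
  have hs1 : HasSubst (![X 0, X 0 * X 1] : Fin 2 → MvPowerSeries (Fin 2) k) :=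
    hasSubst_of_constantCoeff_zero fun i => by fin_cases i <;> simp
  have hFG : (fun i => subst (![X 0, X 0 * X 1] : Fin 2 → MvPowerSeries (Fin 2) k)
      ((![X 0, X 1 + X 0 * C c] : Fin 2 → MvPowerSeries (Fin 2) k) i)) =
      (![X 0, X 0 * (X 1 + C c)] : Fin 2 → MvPowerSeries (Fin 2) k) := by
    funext i
    fin_cases i
    · show subst _ (X 0) = X 0
      rw [subst_X hs1]; rfl
    · show subst (![X 0, X 0 * X 1] : Fin 2 → MvPowerSeries (Fin 2) k) (X 1 + X 0 * C c) = X 0 * (X 1 + C c)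
      have hC1 : subst (![X 0, X 0 * X 1] : Fin 2 → MvPowerSeries (Fin 2) k) (C c : MvPowerSeries (Fin 2) k) = C c := by
        rw [← coe_substAlgHom hs1]; exact (substAlgHom hs1).commutes c
      rw [← coe_substAlgHom hs1, map_add, map_mul, coe_substAlgHom, subst_X hs1, subst_X hs1, hC1]
      simp only [Matrix.cons_val_zero, Matrix.cons_val_one]; ring
  have hΦ₂ : ∀ g : MvPowerSeries (Fin 2) k,
      Φ (toThree g) = toThree (subst (![X 0, X 0 * (X 1 + C c)] : Fin 2 → MvPowerSeries (Fin 2) k) g) := by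
    intro g
    rw [hΦapp, hσ₂, hρ₂, h1₂, shear_eq, subst_comp_subst_apply hs2 hs1, hFG]
  -- the bricks
  have hB3 : ∀ (P' : Ideal (MvPowerSeries (Fin 3) k)) [P'.IsPrime], ringKrullDim (MvPowerSeries (Fin 3) k ⧸ P') = 1 →
      (X 0 : MvPowerSeries (Fin 3) k) ∉ P' →
      ringKrullDim (MvPowerSeries (Fin 3) k ⧸ P'.comap Φ) = 1 ∧ ∀ f, branchVal (P'.comap Φ) f = branchVal P' (Φ f) := by
    intro P' _ hdim' hX
    obtain ⟨hd, hv⟩ := branchVal_comap_monomialChart_coordChange Φ₁ 0 h1fix hmon₁ hρ0 (NCPoly.isUnit_det_linMat_recentre _) P' hdim' hX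
    refine ⟨?_, fun f => ?_⟩
    · rw [hcomap, hρdef, hσdef]; exact (ringKrullDim_quotient_comap_shear3 (C c) _).trans hd
    · rw [hcomap, hΦapp, hρdef, hσdef, substAlgHom_apply, substAlgHom_apply]
      exact (branchVal_comap_shear3 (C c) _ f).trans (hv _)
  have hB4 : ∀ (P' : Ideal (MvPowerSeries (Fin 3) k)),
      P' ∈ topPrimes d (blowOneT d (shift d (shearT (C c) A) (prepSelWP d (shearT (C c) A)))) →
      ringKrullDim (MvPowerSeries (Fin 3) k ⧸ P') = 1 → (X 0 : MvPowerSeries (Fin 3) k) ∉ P' → P'.comap Φ ∈ topPrimes d A := by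
    intro P' hP' hdim' hX
    rw [hcomap, hΦ₁def, hρdef, hσdef]
    exact comap_shearRecentre_mem_topPrimes A (C c) _ hψ₁ (comap_chartOne_mem_topPrimes (by omega) _ hpos₁ hP' hX hdim')
  have hD3 : ∀ (P Q : Ideal (MvPowerSeries (Fin 3) k)), P ∈ topPrimes d A → Q ∈ topPrimes d A → P ≠ Q →
      ringKrullDim (MvPowerSeries (Fin 3) k ⧸ P) = 1 → ringKrullDim (MvPowerSeries (Fin 3) k ⧸ Q) = 1 → pairVal P Q < ⊤ :=
    fun P Q hP hQ hne hdP hdQ => pairVal_lt_top hd2 hP hQ hne hdP hdQ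
  have hinj : ∀ (P' Q' : Ideal (MvPowerSeries (Fin 3) k)), P'.IsPrime → Q'.IsPrime → ringKrullDim (MvPowerSeries (Fin 3) k ⧸ P') = 1 →
      ringKrullDim (MvPowerSeries (Fin 3) k ⧸ Q') = 1 → (X 0 : MvPowerSeries (Fin 3) k) ∉ P' → (X 0 : MvPowerSeries (Fin 3) k) ∉ Q' →
      P'.comap Φ = Q'.comap Φ → P' = Q' := by
    intro P' Q' hP hQ hdP hdQ hXP hXQ h
    rw [hcomap, hcomap, hρdef, hσdef] at h
    exact eq_of_comap_monomialChart_coordChange_eq Φ₁ 0 h1fix hmon₁ hρ0 (NCPoly.isUnit_det_linMat_recentre _) hP hQ hdP hdQ hXP hXQ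
      (eq_of_comap_coordChange_eq hσ0 (by rw [det_linMat_shear3]; exact isUnit_one) h)
  have hline := fun (h2' : IsPermissibleTwoT d (blowOneT d (shift d (shearT (C c) A) (prepSelWP d (shearT (C c) A))))) =>
    exists_linePrimeD_of_isPermissibleTwoT h2'
  exact ⟨(conflictBudgetD_translated_leD Φ p hc0 hΦX0 hΦX1 hΦ₂ hB3 hB4 hD3 hinj hline hctx rfl).1, fun hconf =>
    conflictBudgetD_translated_ltD Φ p hc0 hΦX0 hΦX1 hΦ₂ hB3 hB4 hD3 hinj hline hctx hin hconf rfl⟩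

/-- STEP GRAPH MOVE: `Φ = chartDivTwo ∘ recentre ψ₁ ∘ shear3 h₀`, `h₀` the chosen graph shear, `ψ₁` the selected preparation. -/
theorem law_graph (h2 : ¬ IsPermissibleTwoT d A) (h3 : HasGraphCurveT d A) (h1N : (1 : Fin 2) ∉ N) :
    conflictBudgetD d (divTwoT d (shift d (shearT (graphShearT d A) A) (prepSelWP d (shearT (graphShearT d A) A))))
      (insert 1 (N.filter fun l => l = 0)) ≤ conflictBudgetD d A N := by
  have hd2 : 2 ≤ d := NCBranchPrimes.two_le_of_presContext hctx
  obtain ⟨ψ, hh₀, hψ, hperm⟩ := graphShearT_spec h3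
  have hprep : IsPrepRecentring d (shearT (graphShearT d A) A) (prepSelWP d (shearT (graphShearT d A) A)) :=
    TameFourTupleDrop.isPrepRecentring_prepSelWP_all d _ (isPosT_shearT _ hin.2.1)
  have hψ₁ : constantCoeff (prepSelWP d (shearT (graphShearT d A) A)) = 0 := hprep.1
  have hpos₁ : IsPosT d (shift d (shearT (graphShearT d A) A) (prepSelWP d (shearT (graphShearT d A) A))) := hprep.2.1
  have hWP₁ : WellPrepared d (shift d (shearT (graphShearT d A) A) (prepSelWP d (shearT (graphShearT d A) A))) := hprep.2.2.1
  have hperm₁ : IsPermissibleTwoT d (shift d (shearT (graphShearT d A) A) (prepSelWP d (shearT (graphShearT d A) A))) := by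
    have hψ' : constantCoeff (ψ - prepSelWP d (shearT (graphShearT d A) A)) = 0 := by rw [map_sub, hψ, hψ₁, sub_zero]
    refine isPermissibleTwoT_of_shift (by omega) hWP₁ hpos₁ hψ' ?_
    rw [PolyDescent.shift_shift, sub_add_cancel]; exact hperm
  -- the three substitutions, kept opaque
  have hc1 : ∀ i, constantCoeff ((![X 0, X 1, X 1 * X 2] : Fin 3 → MvPowerSeries (Fin 3) k) i) = 0 := by
    intro i; fin_cases i <;> simp
  have ha : HasSubst (![X 0, X 1, X 1 * X 2] : Fin 3 → MvPowerSeries (Fin 3) k) := hasSubst_of_constantCoeff_zero hc1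
  have hρ0 := NCPoly.constantCoeff_recentre hψ₁
  have hσ0 := constantCoeff_shear3 (graphShearT d A)
  obtain ⟨Φ₁, hΦ₁def⟩ : ∃ Φ₁ : MvPowerSeries (Fin 3) k →ₐ[k] MvPowerSeries (Fin 3) k, Φ₁ = substAlgHom ha := ⟨_, rfl⟩
  obtain ⟨ρ, hρdef⟩ : ∃ ρ : MvPowerSeries (Fin 3) k →ₐ[k] MvPowerSeries (Fin 3) k,
    ρ = substAlgHom (hasSubst_of_constantCoeff_zero hρ0) := ⟨_, rfl⟩
  obtain ⟨σ, hσdef⟩ : ∃ σ : MvPowerSeries (Fin 3) k →ₐ[k] MvPowerSeries (Fin 3) k,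
    σ = substAlgHom (hasSubst_of_constantCoeff_zero hσ0) := ⟨_, rfl⟩
  obtain ⟨Φ, hΦdef⟩ : ∃ Φ : MvPowerSeries (Fin 3) k →ₐ[k] MvPowerSeries (Fin 3) k, Φ = (Φ₁.comp ρ).comp σ := ⟨_, rfl⟩
  have hΦapp : ∀ f, Φ f = Φ₁ (ρ (σ f)) := fun f => by rw [hΦdef, AlgHom.comp_apply, AlgHom.comp_apply]
  have hcomap : ∀ I : Ideal (MvPowerSeries (Fin 3) k), I.comap Φ = ((I.comap Φ₁).comap ρ).comap σ := fun I => by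
    rw [hΦdef, Ideal.comap_comapₐ, Ideal.comap_comapₐ, AlgHom.comp_assoc]
  have h1X : ∀ i, Φ₁ (X i) = (![X 0, X 1, X 1 * X 2] : Fin 3 → MvPowerSeries (Fin 3) k) i := fun i => by
    rw [hΦ₁def, substAlgHom_apply, subst_X ha]
  have h1fix : Φ₁ (X 1) = X 1 := by rw [h1X]; rfl
  have h1X0 : Φ₁ (X 0) = X 0 := by rw [h1X]; rfl
  have hmon₁ : ∀ i : Fin 3, Φ₁ (X i) = X i ∨ Φ₁ (X i) = X 1 * X i := by
    intro i; rw [h1X]; fin_cases i <;> simp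
  have h1₂ : ∀ g : MvPowerSeries (Fin 2) k, Φ₁ (toThree g) = toThree g := fun g => by
    rw [hΦ₁def, substAlgHom_apply]; exact subst_toThree_of_fix hc1 (by simp) (by simp) g
  have hσX : ∀ i, σ (X i) = shear3 (graphShearT d A) i := fun i => by
    rw [hσdef, substAlgHom_apply, subst_X (hasSubst_of_constantCoeff_zero hσ0)]
  have hσX0 : σ (X 0) = X 0 := by rw [hσX]; rfl
  have hσX1 : σ (X 1) = X 1 + X 0 * toThree (graphShearT d A) := by rw [hσX]; rfl
  have hσ₂ : ∀ g : MvPowerSeries (Fin 2) k, σ (toThree g) = toThree (shear (graphShearT d A) g) := fun g => by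
    rw [hσdef, substAlgHom_apply]; exact subst_shear3_toThree _ g
  have hρX : ∀ i, ρ (X i) = NCPoly.recentre (prepSelWP d (shearT (graphShearT d A) A)) i := fun i => by
    rw [hρdef, substAlgHom_apply, subst_X (hasSubst_of_constantCoeff_zero hρ0)]
  have hρX0 : ρ (X 0) = X 0 := by rw [hρX]; exact NCPoly.recentre_of_ne _ (by decide)
  have hρX1 : ρ (X 1) = X 1 := by rw [hρX]; exact NCPoly.recentre_of_ne _ (by decide)
  have hρ₂ : ∀ g : MvPowerSeries (Fin 2) k, ρ (toThree g) = toThree g := fun g => by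
    rw [hρdef, substAlgHom_apply]; exact subst_recentre_toThree hψ₁ g
  have hΦX0 : Φ (X 0) = X 0 := by rw [hΦapp, hσX0, hρX0, h1X0]
  have hΦℓ : Φ (X 1 - X 0 * toThree (graphShearT d A)) = X 1 := by
    rw [hΦapp, map_sub, map_mul, hσX1, hσX0, hσ₂, shear_eq_self_of_noY _ _ hh₀, add_sub_cancel_right, hρX1, h1fix]
  have hΦ₂ : ∀ g : MvPowerSeries (Fin 2) k, Φ (toThree g) = toThree (shear (graphShearT d A) g) := fun g => by
    rw [hΦapp, hσ₂, hρ₂, h1₂]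
  -- the bricks
  have hB3 : ∀ (P' : Ideal (MvPowerSeries (Fin 3) k)) [P'.IsPrime], ringKrullDim (MvPowerSeries (Fin 3) k ⧸ P') = 1 →
      (X 1 : MvPowerSeries (Fin 3) k) ∉ P' →
      ringKrullDim (MvPowerSeries (Fin 3) k ⧸ P'.comap Φ) = 1 ∧ ∀ f, branchVal (P'.comap Φ) f = branchVal P' (Φ f) := by
    intro P' _ hdim' hX
    obtain ⟨hd, hv⟩ := branchVal_comap_monomialChart_coordChange Φ₁ 1 h1fix hmon₁ hρ0 (NCPoly.isUnit_det_linMat_recentre _) P' hdim' hX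
    refine ⟨?_, fun f => ?_⟩
    · rw [hcomap, hρdef, hσdef]; exact (ringKrullDim_quotient_comap_shear3 _ _).trans hd
    · rw [hcomap, hΦapp, hρdef, hσdef, substAlgHom_apply, substAlgHom_apply]
      exact (branchVal_comap_shear3 _ _ f).trans (hv _)
  have hB4 : ∀ (P' : Ideal (MvPowerSeries (Fin 3) k)),
      P' ∈ topPrimes d (divTwoT d (shift d (shearT (graphShearT d A) A) (prepSelWP d (shearT (graphShearT d A) A)))) →
      ringKrullDim (MvPowerSeries (Fin 3) k ⧸ P') = 1 → (X 1 : MvPowerSeries (Fin 3) k) ∉ P' → P'.comap Φ ∈ topPrimes d A := by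
    intro P' hP' hdim' hX
    rw [hcomap, hΦ₁def, hρdef, hσdef]
    exact comap_shearRecentre_mem_topPrimes A (graphShearT d A) _ hψ₁ (comap_chartDivTwo_mem_topPrimes (by omega) _ hperm₁ hP' hX hdim')
  have hD3 : ∀ (P Q : Ideal (MvPowerSeries (Fin 3) k)), P ∈ topPrimes d A → Q ∈ topPrimes d A → P ≠ Q →
      ringKrullDim (MvPowerSeries (Fin 3) k ⧸ P) = 1 → ringKrullDim (MvPowerSeries (Fin 3) k ⧸ Q) = 1 → pairVal P Q < ⊤ :=
    fun P Q hP hQ hne hdP hdQ => pairVal_lt_top hd2 hP hQ hne hdP hdQ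
  have hinj : ∀ (P' Q' : Ideal (MvPowerSeries (Fin 3) k)), P'.IsPrime → Q'.IsPrime → ringKrullDim (MvPowerSeries (Fin 3) k ⧸ P') = 1 →
      ringKrullDim (MvPowerSeries (Fin 3) k ⧸ Q') = 1 → (X 1 : MvPowerSeries (Fin 3) k) ∉ P' → (X 1 : MvPowerSeries (Fin 3) k) ∉ Q' →
      P'.comap Φ = Q'.comap Φ → P' = Q' := by
    intro P' Q' hP hQ hdP hdQ hXP hXQ h
    rw [hcomap, hcomap, hρdef, hσdef] at h
    exact eq_of_comap_monomialChart_coordChange_eq Φ₁ 1 h1fix hmon₁ hρ0 (NCPoly.isUnit_det_linMat_recentre _) hP hQ hdP hdQ hXP hXQ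
      (eq_of_comap_coordChange_eq hσ0 (by rw [det_linMat_shear3]; exact isUnit_one) h)
  have hNL : ∀ P ∈ topPrimes d A, ringKrullDim (MvPowerSeries (Fin 3) k ⧸ P) = 1 → (X 0 : MvPowerSeries (Fin 3) k) ∉ P →
      (X 1 : MvPowerSeries (Fin 3) k) ∉ P :=
    fun P hP hdim hX0 => X_one_not_mem_of_wellPrepared (by omega) hin.1 hin.2.1 h2 hP hdim hX0
  exact conflictBudgetD_graph_leD Φ p (shear (graphShearT d A)) hh₀ hψ hperm hin h2 h1N hΦX0 hΦℓ hΦ₂ hB3 hB4 hD3 hinj hNL hctx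
    (by simp)

/-- **THE SUCC-LAW of the conflict budget `conflictBudgetD`.** -/
theorem conflictBudgetD_succ_law {A' : Fin d → MvPowerSeries (Fin 2) k} {N' : Finset (Fin 2)} (_hin' : InPoly d A')
    (hsel : SuccFamilySel d (prepSelWP (k := k) d) A N A' N') : conflictBudgetD d A' N' ≤ conflictBudgetD d A N := by
  rcases hsel with ⟨h1, rfl, rfl⟩ | ⟨-, h2, rfl, rfl⟩ | ⟨-, h2, h3, h1N, rfl, rfl⟩ | ⟨-, -, -, hpt⟩
  · exact law_divOne p hctx hin h1
  · exact law_divTwo p hctx hin h2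
  · exact law_graph p hctx hin h2 h3 h1N
  · rcases hpt with ⟨rfl, rfl⟩ | ⟨c, hc, rfl, rfl⟩ | ⟨rfl, rfl⟩
    · exact (law_blowOne p hctx hin).1
    · exact (law_translated p hctx hin hc).1
    · exact (law_blowTwo p hctx hin).1

/-- **THE CONF-LAW of the conflict budget `conflictBudgetD`.** -/
theorem conflictBudgetD_conf_law {A' : Fin d → MvPowerSeries (Fin 2) k} {N' : Finset (Fin 2)} (_hin' : InPoly d A')
    (hconf : NCPoly.Conflict d A N) (hpt : PointFamilySel d (prepSelWP (k := k) d) A N A' N') :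
    conflictBudgetD d A' N' < conflictBudgetD d A N := by
  rcases hpt with ⟨rfl, rfl⟩ | ⟨c, hc, rfl, rfl⟩ | ⟨rfl, rfl⟩
  · exact (law_blowOne p hctx hin).2 hconf
  · exact (law_translated p hctx hin hc).2 hconf
  · exact (law_blowTwo p hctx hin).2 hconf

end Laws

end TOT2Branch

end Summit.ResolutionOfSingularities.ResolutionOfSingularities.Theorems

end
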